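import Summits.ResolutionOfSingularities.ResolutionOfSingularities.Theorems.WeightedInvariantKeyRungThreeOfDropB
import HarnessLib

/-!
# (DROP)₃ REDUCED TO (D-b³): the `ι₃ᵗ`-drop over the closed point at POINT and CURVE centres of THREE-dimensional door positions
# (door `HypersurfaceCentreConstruction`, stmt-ResolutionOfSingularities-19897; gap list of `stub_keyRungGrHomLE_three`)

Helper for `stub_keyRungGrHomLE_three` (def-free, `--supports 19897`).  Sharpening of …KeyRungThreeOfDropB: the divisor centres (`ht P ≤ 1`)
have no singular successor at all (`DivCentre.weightedDrop_of_dim_le_one`) and TYPE (a) (`Iota3.iotaFlatT_successor_lt_of_over_generic_point`)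
also covers the point centre of a SURFACE (`P = 𝔪`, `dim S = 2`), so by a height count the only successors left are those over the closed
point at positions with `dim S = 3` and `ht P ≥ 2` — the point regimes (`P = 𝔪`: ISOLATED, TIE, CROSSING) and the curve regimes (`ht P = 2`).
* **`Iota3.weightedDropHom_of_dropb3`** — (DROP)₃ at a door position ⟸ (D-b³) at that position: the `ι₃ᵗ`-drop at the `t`-homogeneous
  successors over `𝔪` demanded ONLY when `ringKrullDim S = 3` and `¬ ringKrullDim S_P ≤ 1`.
* **`Iota3.canonicalGameClauseHomLE_three_of_dropb3`**, **`keyRungGrHomLE_three_of_tieDescent_dropb3`**, **`keyRungGrHomLE_three_of_c11_dropb3`**,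
  **`pRungGrHomLE_three_of_tieDescent_dropb3`** — THE GAP LISTS OF RECORD: the typing item (hD / (c11)≤3 as typed) + **(D-b³)**.
[OURS · L1 W4.3 · audit glue; AI work, weaker than expert review; nothing here is a statement of the manuscript under review.]

## References

* H. Matsumura, *Commutative Ring Theory* (1987), §5 (heights). [Matsumura1987]
-/

noncomputable section

set_option linter.dupNamespace false -- mandated namespace of this single-conjunct summit

open IsLocalRing Literature.AlgebraicGeometry.Resolution
open Summit.ResolutionOfSingularities.ResolutionOfSingularities.Theorems
open Summit.ResolutionOfSingularities.ResolutionOfSingularities.Theorems.ContactCylinder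

namespace Summit.ResolutionOfSingularities.ResolutionOfSingularities.Cruxes.HypersurfaceCentreConstruction.LocalEngine

namespace Iota3

/-- A prime of a local ring of Krull dimension `≤ 3` has a natural-number height `≤ 3`. [folklore] -/
theorem exists_height_eq_nat_of_ringKrullDim_le_three {S : Type} [CommRing S] [IsLocalRing S] (hd : ringKrullDim S ≤ 3)
    (I : Ideal S) [I.IsPrime] : ∃ k : ℕ, I.height = k ∧ k ≤ 3 := by
  have h𝔪 := height_maximalIdeal_le_of_ringKrullDim_le_three hd
  have h3 : ((2 : ℕ) : ℕ∞) + 1 = ((3 : ℕ) : ℕ∞) := by norm_num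
  rw [h3] at h𝔪
  have hI : I.height ≤ ((3 : ℕ) : ℕ∞) := (Ideal.height_mono (IsLocalRing.le_maximalIdeal (Ideal.IsPrime.ne_top ‹_›))).trans h𝔪
  have hne : I.height ≠ ⊤ := fun h => by rw [h] at hI; exact ENat.coe_ne_top 3 (top_le_iff.mp hI)
  obtain ⟨k, hk⟩ := ENat.ne_top_iff_exists.mp hne
  exact ⟨k, hk.symm, by rw [← hk] at hI; exact_mod_cast hI⟩

/-- **(DROP)₃ AT A DOOR POSITION ⟸ (D-b³) AT THAT POSITION.**  As `weightedDropHom_of_drop_over_closedPoint_door`, but the drop over the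
closed point is demanded only when `ringKrullDim S = 3` and `¬ ringKrullDim S_P ≤ 1` (point and curve centres in threefolds): divisor centres
have no singular successor (`DivCentre.weightedDrop_of_dim_le_one`), the point centre of a surface is TYPE (a)
(`iotaFlatT_successor_lt_of_over_generic_point` with `Q = P = 𝔪`, `dim S ≤ 2`), and the remaining configurations are excluded by heights.
[OURS · L1 W4.3 · (DROP)₃ ⟸ (D-b³)] -/
theorem weightedDropHom_of_dropb3 (p : ℕ) (k₀ : Type) [Field k₀] [CharP k₀ p] [PerfectField k₀]
    (S : Type) [CommRing S] [IsRegularLocalRing S] [Algebra k₀ S] [Algebra.EssFiniteType k₀ S]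
    {f : S} (hd : ringKrullDim S ≤ 3) (hf0 : f ≠ 0) (hf2 : f ∈ (maximalIdeal S) ^ 2)
    (P : Ideal S) [P.IsPrime] (hfP : f ∈ P) (hE : topStratum iotaOrdEpsTau S f = {𝔮 | P ≤ 𝔮.asIdeal})
    {n : ℕ} (u : Fin n → S) (w : Fin n → ℕ)
    (hspan : Ideal.span (Set.range u) = maximalIdeal S) (hrk : (maximalIdeal S).spanFinrank = n)
    (hctr : Ideal.span {x | ∃ i, 0 < w i ∧ x = u i} = P)
    (hpres : ∀ m : ℕ, weightedMonomialIdeal u w m = jFlatT S f m)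
    (hb : ringKrullDim S = 3 → ¬ ringKrullDim (Localization.AtPrime P) ≤ 1 →
      ∀ (𝔫 : Ideal (cobordantAlgebra' u w)) [𝔫.IsPrime], IsTHomogeneous u w 𝔫 → cobordantT' u w ∈ 𝔫 →
      (maximalIdeal S).map (algebraMap S (cobordantAlgebra' u w)) ≤ 𝔫 →
      ¬ extReesAlgebra.vertexIdeal (weightedMonomialIdeal u w) ≤ 𝔫 →
      ∀ (a : ℕ) (g : cobordantAlgebra' u w), algebraMap S (cobordantAlgebra' u w) f = cobordantT' u w ^ a * g →
        ¬ cobordantT' u w ∣ g →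
        algebraMap (cobordantAlgebra' u w) (Localization.AtPrime 𝔫) g ∈ maximalIdeal (Localization.AtPrime 𝔫) ^ 2 →
        iotaFlatT (Localization.AtPrime 𝔫) (algebraMap (cobordantAlgebra' u w) (Localization.AtPrime 𝔫) g) < iotaFlatT S f) :
    WeightedDropHom iotaFlatT S f P u w := by
  intro 𝔫 _ hhom hT hP𝔫 hV a g hfg hTg hg2
  haveI hQ : (𝔫.comap (algebraMap S (cobordantAlgebra' u w))).IsPrime := Ideal.IsPrime.comap _
  have hPQ : P ≤ 𝔫.comap (algebraMap S (cobordantAlgebra' u w)) := fun x hx =>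
    Ideal.mem_comap.mpr (hP𝔫 (Ideal.mem_map_of_mem _ hx))
  -- heights as natural numbers
  obtain ⟨m𝔪, hm𝔪, hm𝔪3⟩ := exists_height_eq_nat_of_ringKrullDim_le_three hd (maximalIdeal S)
  obtain ⟨hP, hhP, -⟩ := exists_height_eq_nat_of_ringKrullDim_le_three hd P
  obtain ⟨hQn, hhQ, -⟩ := exists_height_eq_nat_of_ringKrullDim_le_three hd (𝔫.comap (algebraMap S (cobordantAlgebra' u w)))
  have hPQle : hP ≤ hQn := by
    have := Ideal.height_mono hPQ; rw [hhP, hhQ] at this; exact_mod_cast this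
  have hQ𝔪le : hQn ≤ m𝔪 := by
    have := Ideal.height_mono (IsLocalRing.le_maximalIdeal hQ.ne_top); rw [hhQ, hm𝔪] at this; exact_mod_cast this
  have hdimS : ringKrullDim S = m𝔪 := by rw [← IsLocalRing.maximalIdeal_height_eq_ringKrullDim, hm𝔪]; rfl
  have hdimP : ∀ k : ℕ, hP ≤ k → ringKrullDim (Localization.AtPrime P) ≤ k := fun k hk =>
    ringKrullDim_localization_le_of_height_le P (by rw [hhP]; exact_mod_cast hk)
  -- divisor centres: no singular successor at all
  by_cases h1 : hP ≤ 1
  · exact DivCentre.weightedDrop_of_dim_le_one S hf0 P hfP hE (by exact_mod_cast hdimP 1 h1) u w hspan hrk hctr hpres iotaFlatT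
      𝔫 hT hP𝔫 hV a g hfg hTg hg2
  -- TYPE (a) (including the point centre of a surface)
  by_cases h2 : 𝔫.comap (algebraMap S (cobordantAlgebra' u w)) = P ∧ hP ≤ 2
  · exact iotaFlatT_successor_lt_of_over_generic_point p k₀ S hf0 hf2 P hE (by exact_mod_cast hdimP 2 h2.2) u w hpres 𝔫 hT
      hP𝔫 hV h2.1.le a g hfg hTg hg2
  -- otherwise the successor lies over the closed point of a threefold, at a point or curve centre
  have hQm : 𝔫.comap (algebraMap S (cobordantAlgebra' u w)) = maximalIdeal S := by
    by_contra hQm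
    have hQlt : 𝔫.comap (algebraMap S (cobordantAlgebra' u w)) < maximalIdeal S :=
      lt_of_le_of_ne (IsLocalRing.le_maximalIdeal hQ.ne_top) hQm
    have hQ1 : hQn + 1 ≤ m𝔪 := by
      have := Ideal.height_add_one_le_of_lt_of_isPrime hQlt; rw [hhQ, hm𝔪] at this; exact_mod_cast this
    by_cases hQP : 𝔫.comap (algebraMap S (cobordantAlgebra' u w)) = P
    · exact h2 ⟨hQP, by omega⟩
    · have hPlt : P < 𝔫.comap (algebraMap S (cobordantAlgebra' u w)) := lt_of_le_of_ne hPQ (Ne.symm hQP)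
      have hP1 : hP + 1 ≤ hQn := by
        have := Ideal.height_add_one_le_of_lt_of_isPrime hPlt; rw [hhP, hhQ] at this; exact_mod_cast this
      exact h1 (by omega)
  have hm3 : m𝔪 = 3 := by
    by_cases hPm : P = maximalIdeal S
    · have : hP = m𝔪 := by
        have := hhP; rw [hPm, hm𝔪] at this; exact_mod_cast this.symm
      have h2' : ¬ hP ≤ 2 := fun h => h2 ⟨hQm.trans hPm.symm, h⟩
      omega
    · have hPlt : P < maximalIdeal S := lt_of_le_of_ne (IsLocalRing.le_maximalIdeal (Ideal.IsPrime.ne_top ‹_›)) hPm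
      have hP1 : hP + 1 ≤ m𝔪 := by
        have := Ideal.height_add_one_le_of_lt_of_isPrime hPlt; rw [hhP, hm𝔪] at this; exact_mod_cast this
      omega
  have hd3 : ringKrullDim S = 3 := by rw [hdimS, hm3]; rfl
  have hnP1 : ¬ ringKrullDim (Localization.AtPrime P) ≤ 1 := fun h => by
    rw [IsLocalization.AtPrime.ringKrullDim_eq_height P (Localization.AtPrime P), hhP] at h
    exact h1 (by exact_mod_cast h)
  exact hb hd3 hnP1 𝔫 hhom hT (by rw [← hQm]; exact Ideal.map_comap_le) hV a g hfg hTg hg2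

/-- **hgame ⟸ (D-b³).** [OURS · L1 W4.3 · audit glue] -/
theorem canonicalGameClauseHomLE_three_of_dropb3 (p : ℕ)
    (hDROPb : ∀ (k₀ : Type) [Field k₀] [CharP k₀ p] [PerfectField k₀]
      (S : Type) [CommRing S] [Algebra k₀ S] [Algebra.EssFiniteType k₀ S] [IsRegularLocalRing S]
      (f : S), ringKrullDim S = 3 → f ≠ 0 → f ∈ (maximalIdeal S) ^ 2 →
      ∀ (P : Ideal S) [P.IsPrime], IsRegularLocalRing (S ⧸ P) → f ∈ P →
        topStratum iotaOrdEpsTau S f = {𝔮 | P ≤ 𝔮.asIdeal} → ¬ ringKrullDim (Localization.AtPrime P) ≤ 1 →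
        ∀ (n : ℕ) (u : Fin n → S) (w : Fin n → ℕ),
          Ideal.span (Set.range u) = maximalIdeal S → (maximalIdeal S).spanFinrank = n → (∃ i, 0 < w i) →
          Ideal.span {x | ∃ i, 0 < w i ∧ x = u i} = P →
          (∀ m : ℕ, weightedMonomialIdeal u w m = jFlatT S f m) →
          ∀ (𝔫 : Ideal (cobordantAlgebra' u w)) [𝔫.IsPrime], IsTHomogeneous u w 𝔫 → cobordantT' u w ∈ 𝔫 →
            (maximalIdeal S).map (algebraMap S (cobordantAlgebra' u w)) ≤ 𝔫 →
            ¬ extReesAlgebra.vertexIdeal (weightedMonomialIdeal u w) ≤ 𝔫 →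
            ∀ (a : ℕ) (g : cobordantAlgebra' u w), algebraMap S (cobordantAlgebra' u w) f = cobordantT' u w ^ a * g →
              ¬ cobordantT' u w ∣ g →
              algebraMap (cobordantAlgebra' u w) (Localization.AtPrime 𝔫) g ∈ maximalIdeal (Localization.AtPrime 𝔫) ^ 2 →
              iotaFlatT (Localization.AtPrime 𝔫) (algebraMap (cobordantAlgebra' u w) (Localization.AtPrime 𝔫) g) <
                iotaFlatT S f) :
    CanonicalGameClauseHomLE 3 p iotaFlatT jFlatT :=
  canonicalGameClauseHomLE_three_of_drop p fun k₀ _ _ _ S _ _ _ _ f hd hf0 hf2 P _ hreg hfP hE n u w h1 h2 h3 h4 h5 =>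
    weightedDropHom_of_dropb3 p k₀ S hd hf0 hf2 P hfP hE u w h1 h2 h4 h5
      (fun hd3 hP1 => hDROPb k₀ S f hd3 hf0 hf2 P hreg hfP hE hP1 n u w h1 h2 h3 h4 h5)

end Iota3

open Iota3

/-- **GAP LIST OF RECORD for `stub_keyRungGrHomLE_three` — hD + (D-b³).**  `KeyRungGrHomLE 3 p` from hD ((desc-τ) AS TYPED; TYPING ITEM) and
(D-b³): at every door position with `dim S = 3`, canonical centre `P` with `¬ dim S_P ≤ 1` (point and curve centres) and every weighted rsp
presentation `(u, w)` of `(P, J₃ᵗ)`, `ι₃ᵗ` drops at the `t`-homogeneous successor primes over the closed point (`𝔪_S·B ≤ 𝔫`, `t⁻¹ ∈ 𝔫`, off the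
vertex, `f = (t⁻¹)ᵃ g`, `t⁻¹ ∤ g`, `g/1 ∈ 𝔪_𝔫²`) — the characteristic-`p` point drop, the substance of the crux. [OURS · L1 W4.3 · audit glue] -/
theorem keyRungGrHomLE_three_of_tieDescent_dropb3 (p : ℕ)
    (hD : ∀ (T T' : Type) [CommRing T] [IsRegularLocalRing T] [CommRing T'] [IsRegularLocalRing T'] [Algebra T T']
      [IsLocalHom (algebraMap T T')] [Algebra.FormallySmooth T T'] [Algebra.EssFiniteType T T'] (g : T),
      ringKrullDim T' ≤ 3 → IsTiePosition T' (algebraMap T T' g) → IsTiePosition T g)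
    (hDROPb : ∀ (k₀ : Type) [Field k₀] [CharP k₀ p] [PerfectField k₀]
      (S : Type) [CommRing S] [Algebra k₀ S] [Algebra.EssFiniteType k₀ S] [IsRegularLocalRing S]
      (f : S), ringKrullDim S = 3 → f ≠ 0 → f ∈ (maximalIdeal S) ^ 2 →
      ∀ (P : Ideal S) [P.IsPrime], IsRegularLocalRing (S ⧸ P) → f ∈ P →
        topStratum iotaOrdEpsTau S f = {𝔮 | P ≤ 𝔮.asIdeal} → ¬ ringKrullDim (Localization.AtPrime P) ≤ 1 →
        ∀ (n : ℕ) (u : Fin n → S) (w : Fin n → ℕ),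
          Ideal.span (Set.range u) = maximalIdeal S → (maximalIdeal S).spanFinrank = n → (∃ i, 0 < w i) →
          Ideal.span {x | ∃ i, 0 < w i ∧ x = u i} = P →
          (∀ m : ℕ, weightedMonomialIdeal u w m = jFlatT S f m) →
          ∀ (𝔫 : Ideal (cobordantAlgebra' u w)) [𝔫.IsPrime], IsTHomogeneous u w 𝔫 → cobordantT' u w ∈ 𝔫 →
            (maximalIdeal S).map (algebraMap S (cobordantAlgebra' u w)) ≤ 𝔫 →
            ¬ extReesAlgebra.vertexIdeal (weightedMonomialIdeal u w) ≤ 𝔫 →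
            ∀ (a : ℕ) (g : cobordantAlgebra' u w), algebraMap S (cobordantAlgebra' u w) f = cobordantT' u w ^ a * g →
              ¬ cobordantT' u w ∣ g →
              algebraMap (cobordantAlgebra' u w) (Localization.AtPrime 𝔫) g ∈ maximalIdeal (Localization.AtPrime 𝔫) ^ 2 →
              iotaFlatT (Localization.AtPrime 𝔫) (algebraMap (cobordantAlgebra' u w) (Localization.AtPrime 𝔫) g) <
                iotaFlatT S f) :
    KeyRungGrHomLE 3 p :=
  keyRungGrHomLE_three_of_game p hD (canonicalGameClauseHomLE_three_of_dropb3 p hDROPb)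

/-- **GAP LIST OF RECORD, (c11)-form — (c11)≤3 + (D-b³).** [OURS · L1 W4.3 · audit glue] -/
theorem keyRungGrHomLE_three_of_c11_dropb3 (p : ℕ) (hc11 : IotaJEssSmoothCompatibleLE 3 iotaFlatT jFlatT)
    (hDROPb : ∀ (k₀ : Type) [Field k₀] [CharP k₀ p] [PerfectField k₀]
      (S : Type) [CommRing S] [Algebra k₀ S] [Algebra.EssFiniteType k₀ S] [IsRegularLocalRing S]
      (f : S), ringKrullDim S = 3 → f ≠ 0 → f ∈ (maximalIdeal S) ^ 2 →
      ∀ (P : Ideal S) [P.IsPrime], IsRegularLocalRing (S ⧸ P) → f ∈ P →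
        topStratum iotaOrdEpsTau S f = {𝔮 | P ≤ 𝔮.asIdeal} → ¬ ringKrullDim (Localization.AtPrime P) ≤ 1 →
        ∀ (n : ℕ) (u : Fin n → S) (w : Fin n → ℕ),
          Ideal.span (Set.range u) = maximalIdeal S → (maximalIdeal S).spanFinrank = n → (∃ i, 0 < w i) →
          Ideal.span {x | ∃ i, 0 < w i ∧ x = u i} = P →
          (∀ m : ℕ, weightedMonomialIdeal u w m = jFlatT S f m) →
          ∀ (𝔫 : Ideal (cobordantAlgebra' u w)) [𝔫.IsPrime], IsTHomogeneous u w 𝔫 → cobordantT' u w ∈ 𝔫 →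
            (maximalIdeal S).map (algebraMap S (cobordantAlgebra' u w)) ≤ 𝔫 →
            ¬ extReesAlgebra.vertexIdeal (weightedMonomialIdeal u w) ≤ 𝔫 →
            ∀ (a : ℕ) (g : cobordantAlgebra' u w), algebraMap S (cobordantAlgebra' u w) f = cobordantT' u w ^ a * g →
              ¬ cobordantT' u w ∣ g →
              algebraMap (cobordantAlgebra' u w) (Localization.AtPrime 𝔫) g ∈ maximalIdeal (Localization.AtPrime 𝔫) ^ 2 →
              iotaFlatT (Localization.AtPrime 𝔫) (algebraMap (cobordantAlgebra' u w) (Localization.AtPrime 𝔫) g) <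
                iotaFlatT S f) :
    KeyRungGrHomLE 3 p :=
  keyRungGrHomLE_three_of_c11_game p hc11 (canonicalGameClauseHomLE_three_of_dropb3 p hDROPb)

/-- **GAP LIST OF RECORD (named-pair form) — hD + (D-b³)**: `PRungGrHomLE 3 p iotaFlatT jFlatT`. [OURS · L1 W4.3 · audit glue] -/
theorem pRungGrHomLE_three_of_tieDescent_dropb3 (p : ℕ)
    (hD : ∀ (T T' : Type) [CommRing T] [IsRegularLocalRing T] [CommRing T'] [IsRegularLocalRing T'] [Algebra T T']
      [IsLocalHom (algebraMap T T')] [Algebra.FormallySmooth T T'] [Algebra.EssFiniteType T T'] (g : T),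
      ringKrullDim T' ≤ 3 → IsTiePosition T' (algebraMap T T' g) → IsTiePosition T g)
    (hDROPb : ∀ (k₀ : Type) [Field k₀] [CharP k₀ p] [PerfectField k₀]
      (S : Type) [CommRing S] [Algebra k₀ S] [Algebra.EssFiniteType k₀ S] [IsRegularLocalRing S]
      (f : S), ringKrullDim S = 3 → f ≠ 0 → f ∈ (maximalIdeal S) ^ 2 →
      ∀ (P : Ideal S) [P.IsPrime], IsRegularLocalRing (S ⧸ P) → f ∈ P →
        topStratum iotaOrdEpsTau S f = {𝔮 | P ≤ 𝔮.asIdeal} → ¬ ringKrullDim (Localization.AtPrime P) ≤ 1 →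
        ∀ (n : ℕ) (u : Fin n → S) (w : Fin n → ℕ),
          Ideal.span (Set.range u) = maximalIdeal S → (maximalIdeal S).spanFinrank = n → (∃ i, 0 < w i) →
          Ideal.span {x | ∃ i, 0 < w i ∧ x = u i} = P →
          (∀ m : ℕ, weightedMonomialIdeal u w m = jFlatT S f m) →
          ∀ (𝔫 : Ideal (cobordantAlgebra' u w)) [𝔫.IsPrime], IsTHomogeneous u w 𝔫 → cobordantT' u w ∈ 𝔫 →
            (maximalIdeal S).map (algebraMap S (cobordantAlgebra' u w)) ≤ 𝔫 →
            ¬ extReesAlgebra.vertexIdeal (weightedMonomialIdeal u w) ≤ 𝔫 →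
            ∀ (a : ℕ) (g : cobordantAlgebra' u w), algebraMap S (cobordantAlgebra' u w) f = cobordantT' u w ^ a * g →
              ¬ cobordantT' u w ∣ g →
              algebraMap (cobordantAlgebra' u w) (Localization.AtPrime 𝔫) g ∈ maximalIdeal (Localization.AtPrime 𝔫) ^ 2 →
              iotaFlatT (Localization.AtPrime 𝔫) (algebraMap (cobordantAlgebra' u w) (Localization.AtPrime 𝔫) g) <
                iotaFlatT S f) :
    PRungGrHomLE 3 p iotaFlatT jFlatT :=
  pRungGrHomLE_three_of_tieDescent_game p hD (canonicalGameClauseHomLE_three_of_dropb3 p hDROPb)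

end Summit.ResolutionOfSingularities.ResolutionOfSingularities.Cruxes.HypersurfaceCentreConstruction.LocalEngine

end
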